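import Mathlib
import HarnessLib

/-!
# D′0 — evaluating a row scan at a complex point

Stub `stub_scan_eval` of THEOREM δ′ ("exchangeable row scans restore") for the crux item
`stmt-ValiantsHypothesis-15886` (`MonotoneRestorationQP`), line `Sketch`.

A ROW SCAN of width `w` on the `n × n` variable matrix `(x_ij)` has templates
`H a b ∈ ℂ[z_0, …, z_{D-1}]` and boundary vectors `u, v`; the transfer matrix of row `i` is
`M_i = (H a b)(z_d := p_{d+1}(row i) = Σ_j x_ij^{d+1})` and the scan value is the polynomial
`F = Σ_{a,b} u_a (M_0 ⋯ M_{n-1})_{ab} v_b`.  Evaluating `F` at a complex point `x` gives the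
coefficient `u ⬝ᵥ (A(r_0) ⋯ A(r_{n-1})) *ᵥ v` of the scalar representation
`r ↦ A(r) = (eval (d ↦ Σ_j r_j^{d+1}) (H a b))_{ab}` on the word of rows `r_i = x (i, ·)`.
This is pure "evaluation is a ring morphism" bookkeeping (Mathlib only).
-/

set_option linter.dupNamespace false

namespace Summit.ValiantsHypothesis.ValiantsHypothesis.Theorems

open Matrix

/-- A ring morphism passes through an entry of an ordered product of square matrices:
`f ((L₀ ⋯ L_{k-1}) a b) = ((f L₀) ⋯ (f L_{k-1})) a b` (`map_list_prod` for `f.mapMatrix`).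
[folklore] -/
theorem scanEval_map_listProd_apply {R S m : Type*} [CommSemiring R] [CommSemiring S]
    [Fintype m] [DecidableEq m] (f : R →+* S) (L : List (Matrix m m R)) (a b : m) :
    f (L.prod a b) = (L.map f.mapMatrix).prod a b := by
  rw [← map_list_prod f.mapMatrix L, RingHom.mapMatrix_apply, Matrix.map_apply]

/-- Evaluation of a substituted polynomial: `eval x (aeval g q) = eval (d ↦ eval x (g d)) q`
(Mathlib's `eval₂Hom_bind₁`, restated for `eval ∘ aeval`). [folklore] -/
theorem scanEval_eval_aeval {σ τ : Type*} (x : τ → ℂ) (g : σ → MvPolynomial τ ℂ)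
    (q : MvPolynomial σ ℂ) :
    MvPolynomial.eval x (MvPolynomial.aeval g q) =
      MvPolynomial.eval (fun d => MvPolynomial.eval x (g d)) q :=
  MvPolynomial.eval₂Hom_bind₁ (RingHom.id ℂ) x g q

/-- **D′0 — EVALUATING A ROW SCAN.** At a complex point `x`, the value of the row scan
`(H, u, v)` on the `n × n` variable matrix is the coefficient `u · A(r_0) ⋯ A(r_{n-1}) · v` of the
scalar representation `r ↦ A(r) = H(p_1(r),…,p_D(r))` on the word formed by the rows
`r_i = x (i, ·)` of `x` (evaluation is a ring morphism: it passes through the sums, the ordered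
matrix product and the templates, `MvPolynomial.eval x (aeval g q) = eval (eval x ∘ g) q`).
[folklore] -/
theorem stub_scan_eval (n w D : ℕ) (H : Fin w → Fin w → MvPolynomial (Fin D) ℂ)
    (u v : Fin w → ℂ) (x : Fin n × Fin n → ℂ) :
    MvPolynomial.eval x (∑ a : Fin w, ∑ b : Fin w, MvPolynomial.C (u a) *
        (List.ofFn fun i : Fin n => Matrix.of fun a' b' : Fin w => MvPolynomial.aeval
          (fun d : Fin D => ∑ j : Fin n, (MvPolynomial.X (i, j) : MvPolynomial (Fin n × Fin n) ℂ)
            ^ ((d : ℕ) + 1)) (H a' b')).prod a b *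
        MvPolynomial.C (v b)) =
    u ⬝ᵥ (((List.ofFn fun i : Fin n => fun j : Fin n => x (i, j)).map fun r : Fin n → ℂ =>
        Matrix.of fun a b : Fin w =>
          MvPolynomial.eval (fun d : Fin D => ∑ j : Fin n, r j ^ ((d : ℕ) + 1)) (H a b)).prod).mulVec v := by
  -- the evaluated transfer matrices are the matrices `A(r_i)` of the rows of `x`
  have hfun : ((MvPolynomial.eval x).mapMatrix ∘ fun i : Fin n => Matrix.of fun a' b' : Fin w =>
        MvPolynomial.aeval (fun d : Fin D => ∑ j : Fin n,
          (MvPolynomial.X (i, j) : MvPolynomial (Fin n × Fin n) ℂ) ^ ((d : ℕ) + 1)) (H a' b')) =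
      ((fun r : Fin n → ℂ => Matrix.of fun a b : Fin w =>
          MvPolynomial.eval (fun d : Fin D => ∑ j : Fin n, r j ^ ((d : ℕ) + 1)) (H a b)) ∘
        fun i : Fin n => fun j : Fin n => x (i, j)) := by
    funext i
    ext a' b'
    simp only [Function.comp_apply, RingHom.mapMatrix_apply, Matrix.map_apply, Matrix.of_apply]
    rw [scanEval_eval_aeval]
    simp only [map_sum, map_pow, MvPolynomial.eval_X]
  -- entries of the evaluated ordered product
  have key : ∀ a b : Fin w,
      MvPolynomial.eval x ((List.ofFn fun i : Fin n => Matrix.of fun a' b' : Fin w =>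
        MvPolynomial.aeval (fun d : Fin D => ∑ j : Fin n,
          (MvPolynomial.X (i, j) : MvPolynomial (Fin n × Fin n) ℂ) ^ ((d : ℕ) + 1)) (H a' b')).prod a b) =
      ((List.ofFn fun i : Fin n => fun j : Fin n => x (i, j)).map fun r : Fin n → ℂ =>
        Matrix.of fun a b : Fin w =>
          MvPolynomial.eval (fun d : Fin D => ∑ j : Fin n, r j ^ ((d : ℕ) + 1)) (H a b)).prod a b := by
    intro a b
    rw [scanEval_map_listProd_apply, List.map_ofFn, List.map_ofFn, hfun]
  -- push `eval x` through the boundary sums and unfold `u ⬝ᵥ P *ᵥ v`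
  simp only [map_sum, map_mul, MvPolynomial.eval_C, key]
  simp only [dotProduct, Matrix.mulVec, Finset.mul_sum, mul_assoc]

end Summit.ValiantsHypothesis.ValiantsHypothesis.Theorems
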